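import Summits.QuantumAdvantage.QuantumAdvantage.Theses.ScaleDial
import Summits.QuantumAdvantage.QuantumAdvantage.Theorems.ScaleDialC

/-!
# ScaleDial — the split glue `ScaleSplitGlue3` (item stmt-QuantumAdvantage-26907) and the assembly (26908)

Route `route-QuantumAdvantage-ScaleDial` (decomp-qadv, lens-1 g12 «ScaleDial», writer g7; D-0170 child of
ExactnessDial:MassStep3u) splits `MassStep3u` (26533) into the residual `MesoLift3` (QML3 → QFracU3) and the crux
`TopLift3` (QFracU3 → PolyLossOddU3).  The glue binder of the route's `closes` — `MesoLift3 → TopLift3 → MassStep3u` —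
is the easy direction of the node's exact split `Theorems.ScaleDial.massStep3u_iff_pieces`, available in the tree as
`Theorems.ScaleDial.closes_26533` (part `ScaleDialC`, landed).  The route's item decls inline `QML3`/`QFracU3` verbatim,
so they agree with the Theorems-side pieces by unfolding.  Census instrument seat decomp-qadv-census-1 g7, on the
writer's note «census-closable on landing» (STATUS ROUTE-BORN 2026-08-30T22:43:23Z).
-/

set_option linter.dupNamespace false

namespace Summit.QuantumAdvantage.QuantumAdvantage.Theorems

/-- **Glue of the ScaleDial split** (item 26907, support): `MesoLift3 → TopLift3 → ExactnessDial.MassStep3u`, by the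
landed `Theorems.ScaleDial.closes_26533` (the route's inlined pieces unfold to the Theorems-side ones). -/
theorem scaleDial_scaleSplitGlue3 : Summit.QuantumAdvantage.QuantumAdvantage.Theses.ScaleDial.ScaleSplitGlue3 := by
  unfold Summit.QuantumAdvantage.QuantumAdvantage.Theses.ScaleDial.ScaleSplitGlue3
  intro hM hW
  exact Summit.QuantumAdvantage.QuantumAdvantage.Theorems.ScaleDial.closes_26533 hM hW

/-- **Assembly of route ScaleDial** (item 26908): the route's pieces in rank order yield `MassStep3u` — the deciding
theorem `Theses.ScaleDial.closes`, binder for binder (the glue is one of its binders). -/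
theorem scaleDial_assembly : Summit.QuantumAdvantage.QuantumAdvantage.Theses.ScaleDial.Assembly :=
  Summit.QuantumAdvantage.QuantumAdvantage.Theses.ScaleDial.closes

end Summit.QuantumAdvantage.QuantumAdvantage.Theorems
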